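import Literature.NumberTheory.Automorphic.UnitaryGroupFrameStabiliser
import Mathlib.NumberTheory.NumberField.InfinitePlace.Embeddings
import HarnessLib

/-!
# Case (A) of [Del71] Prop. 1.15 for `U(W^⊥) ↪ U(V)`: a stabilising rational witness at `B`-adapted depth `n ≥ 3` is `embRational γ⋆`

Sequel of ★ `UnitaryGroupFrameStabiliser` ([Deligne1971TravauxShimura] Prop. 1.15, proof pp. 132–133, read for the unitary sub-datum
`U(W^⊥) ↪ U(V)`, `W = B·(0 ⊕ E)` a line of a frame `ᵗ(cB)·(a•H)·B = J₁ ⊕ᶠ J₂`).  PROOF FILE, theorems only (no definition, no named fact,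
no instance, no `sorry`).

* §1 (`N₂ = 1`) `eq_one_of_mem_arithmeticLevel_fin_one` — an element of `U(J₂)(F) ≤ GL₁(E)` lying in the
  arithmetic level of a level `≤ K_{U(J₂),f}(n𝓞_E)`, `n ≥ 3`, is `1`: its entry `ζ` is an algebraic integer (`γ ≡ 1 (mod n)`) with `c(ζ)ζ = 1`,
  so all its conjugates have absolute value `1` and `ζ` is a root of unity (Kronecker, Mathlib `NumberField.Embeddings.pow_eq_one_of_norm_eq_one`);
  hence `γ` has finite order and is `1` by Minkowski (★ `torsionFree_arithmeticLevel`).  (The general-`N` determinant form is ★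
  `det_eq_one_of_mem_arithmeticLevel` of `UnitaryGroupLevelDet`.)
* §2 HEAD `exists_eq_embRational_of_mulVec_frameEmb_of_mem_level` — a rational witness `γ ∈ U(H)(F)` stabilising `W^⊥` whose coset datum
  `φ(u)⁻¹·γ_f·φ(u′)` lies in a level `K ≤ B_f·K_{U(J₁ ⊕ᶠ J₂),f}(n𝓞_E)·B_f⁻¹` with `n ≥ 3` IS `embRational γ⋆` (`φ = R_B ∘ (· ⊕ 1)`, ★ `φGS` at
  `(2,1)`): by ★ `exists_eq_conj_rationalBlockDiag_of_mulVec_frameEmb` `γ = B·(γ⋆ ⊕ᶠ ζ)·B⁻¹`, the level splits blockwise (★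
  `finAdelicCongr_finAdelicBlockDiag_mem_map_iff`), and `ζ = 1` by §1.  + the CM specialisation `…_cm` (`hfix` = ★ `complexConj_smul_infinitePlace`).

Use (cell `hodgecm-mathlib`, road (ii) R2-1-inj): §2 is the hypothesis `hcaseA` of ★ `ShimuraSetGS.embPoints_injective_of_witnesses`
(`UnitaryShimuraCurveEmbeddingInjective.lean`, A-p15) at every `B`-adapted level of depth `3 ≤ n`.  Books 0; HC_CM is proved only modulo the
printed citations until rung 0 closes.

## References
* [Deligne1971TravauxShimura] P. Deligne, *Travaux de Shimura*, Sém. Bourbaki 389 (1971), Prop. 1.15 and its proof pp. 132–133.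
* [Milne2005ShimuraVarieties] J. S. Milne, *Introduction to Shimura varieties* (2005), Thm. 5.16 and Rem. 13.8.
* [Minkowski1887] H. Minkowski, J. reine angew. Math. 101 (1887), §1 (via ★ `torsionFree_arithmeticLevel`); [PlatonovRapinchuk1994] §4.1, §5.1.
-/

set_option autoImplicit false

noncomputable section

namespace Literature.NumberTheory.Automorphic.UnitaryGroup

open _root_.Matrix _root_.NumberField

/-! ## §1 Rank-one second summand: `U(J₂)(F) ≤ GL₁(E)` is read through the determinant and dies at deep level -/

section RankOne

variable {S : Type*} [CommRing S]

/-- An invertible `1 × 1` matrix is `1` iff its determinant is `1`. [folklore] -/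
private theorem GLn_fin_one_eq_one_iff_det (γ : GL (Fin 1) S) : γ = 1 ↔ Matrix.GeneralLinearGroup.det γ = 1 := by
  constructor
  · rintro rfl; exact map_one _
  · intro h
    refine Units.ext (Matrix.ext fun i j => ?_)
    have hi : i = 0 := Subsingleton.elim _ _
    have hj : j = 0 := Subsingleton.elim _ _
    subst hi; subst hj
    have h' := congrArg (fun u : Sˣ => (u : S)) h
    simp only [Matrix.GeneralLinearGroup.val_det_apply, Matrix.det_fin_one, Units.val_one] at h'
    rw [h', Units.val_one, Matrix.one_apply_eq]

variable (F E : Type) [Field F] [NumberField F] [Field E] [NumberField E] [Algebra F E] (c : E ≃ₐ[F] E)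
  (J₂ : Matrix (Fin 1) (Fin 1) E)

omit [NumberField F] [NumberField E] in
/-- `|φ(c x)| = |φ x|` for every complex embedding `φ` when `c` fixes the infinite places of `E` (private twin of the
three-line ★ `UnitaryGroup.norm_embedding_galConj`). [folklore] -/
private theorem norm_embedding_galConj_of_fix (hfix : ∀ w : NumberField.InfinitePlace E, c • w = w) (φ : E →+* ℂ) (x : E) :
    ‖φ (c x)‖ = ‖φ x‖ := by
  have h := congrArg (fun w : NumberField.InfinitePlace E => w (c x)) (hfix (NumberField.InfinitePlace.mk φ))
  simpa only [NumberField.InfinitePlace.smul_apply, AlgEquiv.symm_apply_apply, NumberField.InfinitePlace.apply] using h.symm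

omit [NumberField F] in
/-- **The `U(W)`-component dies at deep principal level** (`N₂ = 1`): an element `γ = (ζ) ∈ U(J₂)(F) ≤ GL₁(E)` lying in the
arithmetic level of a level `K ≤ K_{U(J₂),f}(n𝓞_E)` with `n ≥ 3` is `1` (`det J₂ ≠ 0`, `c` fixing the infinite places of `E`):
`γ ≡ 1 (mod n)` integrally (★ `arithmeticLevel_finCongruenceLevel_span`), so `ζ` is an algebraic integer; `ᵗ(cγ)·J₂·γ = J₂` gives
`c(ζ)·ζ = 1`, so every conjugate of `ζ` has absolute value `1` and `ζ` is a root of unity (Kronecker, Mathlib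
`NumberField.Embeddings.pow_eq_one_of_norm_eq_one`); hence `γ` has finite order and is `1` because `Γ(K)` is torsion-free for
`K ≤ K(n)`, `n ≥ 3` (Minkowski, ★ `torsionFree_arithmeticLevel`).  This is the step «`ζ c(ζ) = 1`, `ζ ≡ 1 (mod 𝔫)`, `3 ∣ 𝔫` ⇒ `ζ = 1`»
of the injectivity argument; the general-`N` determinant form is ★ `det_eq_one_of_mem_arithmeticLevel`.
[cite: Minkowski1887, §1] [cite: Deligne1971TravauxShimura, Prop. 1.15 (proof, p. 132)] -/
theorem eq_one_of_mem_arithmeticLevel_fin_one (hfix : ∀ w : NumberField.InfinitePlace E, c • w = w)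
    (hJ₂ : J₂.det ≠ 0) {K : Subgroup (finAdelic F E c 1 J₂)} {n : ℕ} (hn : 3 ≤ n)
    (hKn : K ≤ finCongruenceLevel F E c 1 J₂ (Ideal.span {(n : NumberField.RingOfIntegers E)}))
    {γ : GL (Fin 1) E} (hγ : γ ∈ arithmeticLevel F E c 1 J₂ K) : γ = 1 := by
  refine torsionFree_arithmeticLevel hn hKn γ hγ ?_
  -- `γ ∈ Γ(n)`: unitary and `≡ 1 (mod n)` integrally
  have hγn : γ ∈ Literature.AlgebraicGeometry.ShimuraVarieties.principalCongruenceSubgroup (c : E →+* E) J₂ n := by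
    rw [← arithmeticLevel_finCongruenceLevel_span (F := F) (E := E) (c := c) (N := 1) (J := J₂) (by omega)]
    exact arithmeticLevel_mono hKn hγ
  rw [Literature.AlgebraicGeometry.ShimuraVarieties.mem_principalCongruenceSubgroup_iff,
    Literature.AlgebraicGeometry.ShimuraVarieties.unitaryGroup_eq_unitaryGroupOfForm] at hγn
  obtain ⟨hu, ⟨A, hA⟩, -⟩ := hγn
  set ζ : E := (γ : Matrix (Fin 1) (Fin 1) E) 0 0 with hζdef
  -- `ζ = 1 + n·a` is an algebraic integer
  have hζ : ζ = algebraMap (NumberField.RingOfIntegers E) E (1 + (n : NumberField.RingOfIntegers E) * A 0 0) := by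
    have h := congrFun (congrFun hA 0) 0
    rw [Matrix.add_apply, Matrix.one_apply_eq, Matrix.smul_apply, Matrix.map_apply, nsmul_eq_mul] at h
    rw [hζdef, h, map_add, map_one, map_mul, map_natCast]
  have hint : IsIntegral ℤ ζ := by
    rw [hζ]; exact NumberField.RingOfIntegers.isIntegral_coe _
  -- `c(ζ)·ζ = 1` from `ᵗ(cγ)·J₂·γ = J₂` (entry `(0,0)`, `J₂ 0 0 = det J₂ ≠ 0`)
  have hcζ : c ζ * ζ = 1 := by
    have h := congrFun (congrFun (mem_unitaryGroupOfForm_iff.1 hu) 0) 0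
    simp only [Matrix.mul_apply, Fin.sum_univ_one, Matrix.transpose_apply, Matrix.map_apply] at h
    have h2 : c ζ * J₂ 0 0 * ζ = J₂ 0 0 := h
    have hJ : J₂ 0 0 ≠ 0 := by rwa [Matrix.det_fin_one] at hJ₂
    have h' : (c ζ * ζ) * J₂ 0 0 = 1 * J₂ 0 0 := by rw [one_mul, mul_right_comm]; exact h2
    exact mul_right_cancel₀ hJ h'
  -- all conjugates of `ζ` have absolute value `1`
  have hnorm : ∀ φ : E →+* ℂ, ‖φ ζ‖ = 1 := fun φ => by
    have h := congrArg (fun y => ‖φ y‖) hcζ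
    simp only [map_mul, norm_mul, map_one, norm_one] at h
    rw [norm_embedding_galConj_of_fix F E c hfix φ ζ] at h
    have h0 := norm_nonneg (φ ζ)
    rcases mul_self_eq_one_iff.1 h with h1 | h1
    · exact h1
    · linarith
  -- Kronecker: `ζ` is a root of unity, so `γ` has finite order
  obtain ⟨k, hk, hζk⟩ := NumberField.Embeddings.pow_eq_one_of_norm_eq_one E ℂ hint hnorm
  refine isOfFinOrder_iff_pow_eq_one.2 ⟨k, hk, (GLn_fin_one_eq_one_iff_det (γ ^ k)).2 (Units.ext ?_)⟩
  rw [map_pow, Units.val_pow_eq_pow_val, Matrix.GeneralLinearGroup.val_det_apply, Matrix.det_fin_one, ← hζdef, hζk,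
    Units.val_one]

end RankOne

/-! ## §2 Case (A) of [Del71] 1.15 for `U(W^⊥) ↪ U(V)`: a stabilising witness at `B`-adapted depth `n ≥ 3` is `embRational γ⋆` -/

section CaseA

variable (F E : Type) [Field F] [NumberField F] [Field E] [NumberField E] [Algebra F E]
variable (c : E ≃ₐ[F] E) (N₁ : ℕ) (J₁ : Matrix (Fin N₁) (Fin N₁) E) (J₂ : Matrix (Fin 1) (Fin 1) E)
variable (H : Matrix (Fin (N₁ + 1)) (Fin (N₁ + 1)) E) (B : GL (Fin (N₁ + 1)) E) {a : E} (ha : a ≠ 0)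
variable (hB : formCongr (c : E →+* E) B (a • H) = finSum N₁ 1 J₁ J₂)

omit [NumberField F] in
/-- **Case (A) of the injectivity of `Sh_{K⋆}(U(J₁)) → Sh_K(U(H))` ([Deligne1971TravauxShimura] Prop. 1.15 for the sub-datum
`U(W^⊥) ↪ U(V)`, `W = B·(0 ⊕ E)` a line): a rational witness stabilising `W^⊥` at `B`-adapted depth `n ≥ 3` is in the image of
`U(J₁)(F)`.**  Let `φ : U(J₁)(𝔸_{F,f}) →* U(H)(𝔸_{F,f})` act as `u ↦ B_f·(u ⊕ᶠ 1)·B_f⁻¹` (`hφ`; the tree's ★ `φGS` at `(N₁, N₂) = (2,1)`, by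
★ `φGS_apply`), let `K ≤ B_f·K_{U(J₁ ⊕ᶠ J₂),f}(n𝓞_E)·B_f⁻¹` with `n ≥ 3`, and let `γ ∈ U(H)(F)` satisfy `γ·B(x ⊕ 0) ∈ B(E^{N₁} ⊕ 0)` for all `x`
and `φ(u)⁻¹·γ_f·φ(u′) ∈ K`.  Then `γ = embRational γ⋆` for some `γ⋆ ∈ U(J₁)(F)`: by ★ `exists_eq_conj_rationalBlockDiag_of_mulVec_frameEmb` `γ = B·(γ⋆ ⊕ᶠ ζ)·B⁻¹`; on the finite adeles
`φ(u)⁻¹·γ_f·φ(u′) = B_f·((u⁻¹ γ⋆_f u′) ⊕ᶠ ζ_f)·B_f⁻¹`, so the level hypothesis splits (★ `finAdelicCongr_finAdelicBlockDiag_mem_map_iff`) and gives `ζ_f ∈ K_{U(J₂),f}(n𝓞_E)`; then `ζ = 1` (§1: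
`ζ c(ζ) = 1`, `ζ ≡ 1 (mod n)`, `n ≥ 3`; `det J₂ ≠ 0`, `c` fixing the infinite places).  This is the hypothesis `hcaseA` of
`ShimuraSetGS.embPoints_injective_of_witnesses` (`UnitaryShimuraCurveEmbeddingInjective.lean`, A-p15) at `N₁ = 2`.
[cite: Deligne1971TravauxShimura, Prop. 1.15 (proof, pp. 132–133)] [cite: Milne2005ShimuraVarieties, Thm. 5.16 and Rem. 13.8]
[cite: Minkowski1887, §1] -/
theorem exists_eq_embRational_of_mulVec_frameEmb_of_mem_level (hfix : ∀ w : NumberField.InfinitePlace E, c • w = w)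
    (hJ₁ : J₁.det ≠ 0) (hJ₂ : J₂.det ≠ 0) {n : ℕ} (hn : 3 ≤ n)
    {φ : finAdelic F E c N₁ J₁ →* finAdelic F E c (N₁ + 1) H}
    (hφ : ∀ u, φ u = finAdelicCongr F E c B ha hB (finAdelicBlockDiag F E c N₁ 1 J₁ J₂ (u, 1)))
    {K : Subgroup (finAdelic F E c (N₁ + 1) H)}
    (hK : K ≤ (finCongruenceLevel F E c (N₁ + 1) (finSum N₁ 1 J₁ J₂) (Ideal.span {(n : NumberField.RingOfIntegers E)})).map
      (finAdelicCongr F E c B ha hB).toMonoidHom)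
    (γ : rational F E c (N₁ + 1) H) (u u' : finAdelic F E c N₁ J₁)
    (hV : ∀ x : Fin N₁ → E, ∃ y : Fin N₁ → E,
      ((γ : GL (Fin (N₁ + 1)) E) : Matrix (Fin (N₁ + 1)) (Fin (N₁ + 1)) E) *ᵥ
          ((B : Matrix (Fin (N₁ + 1)) (Fin (N₁ + 1)) E) *ᵥ Fin.append x (0 : Fin 1 → E)) =
        (B : Matrix (Fin (N₁ + 1)) (Fin (N₁ + 1)) E) *ᵥ Fin.append y (0 : Fin 1 → E))
    (hcoset : (φ u)⁻¹ * (rationalToFinAdelic F E c (N₁ + 1) H γ * φ u') ∈ K) :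
    ∃ γs : rational F E c N₁ J₁, γ = embRational F E c N₁ 1 J₁ J₂ H B ha hB γs := by
  -- `γ = B·(γ₁ ⊕ᶠ γ₂)·B⁻¹`
  obtain ⟨⟨γ₁, γ₂⟩, hγ⟩ := exists_eq_conj_rationalBlockDiag_of_mulVec_frameEmb F E c N₁ 1 J₁ J₂ H B ha hB hJ₁ γ.2 hV
  -- on the finite adeles: `γ_f = B_f ((γ₁)_f ⊕ᶠ (γ₂)_f) B_f⁻¹`
  have hγf : rationalToFinAdelic F E c (N₁ + 1) H γ = finAdelicCongr F E c B ha hB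
      (finAdelicBlockDiag F E c N₁ 1 J₁ J₂ (rationalToFinAdelic F E c N₁ J₁ γ₁, rationalToFinAdelic F E c 1 J₂ γ₂)) := by
    rw [finAdelicCongr_finAdelicBlockDiag_rationalToFinAdelic_pair]
    congr 1
    exact Subtype.ext hγ
  -- the coset datum is `B_f ((u⁻¹ (γ₁)_f u′) ⊕ᶠ (γ₂)_f) B_f⁻¹`
  have hprod : (φ u)⁻¹ * (rationalToFinAdelic F E c (N₁ + 1) H γ * φ u') = finAdelicCongr F E c B ha hB
      (finAdelicBlockDiag F E c N₁ 1 J₁ J₂ (u⁻¹ * (rationalToFinAdelic F E c N₁ J₁ γ₁ * u'), rationalToFinAdelic F E c 1 J₂ γ₂)) := by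
    rw [hφ, hφ, hγf, ← map_inv, ← map_mul, ← map_mul, ← map_inv, ← map_mul, ← map_mul, Prod.inv_mk, inv_one,
      Prod.mk_mul_mk, Prod.mk_mul_mk, mul_one, one_mul]
  -- so `(γ₂)_f ∈ K_{U(J₂),f}(n)` and `γ₂ = 1`
  have hmem := hK hcoset
  rw [hprod, finAdelicCongr_finAdelicBlockDiag_mem_map_iff] at hmem
  have hγ₂ : (γ₂ : GL (Fin 1) E) ∈ arithmeticLevel F E c 1 J₂
      (finCongruenceLevel F E c 1 J₂ (Ideal.span {(n : NumberField.RingOfIntegers E)})) :=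
    mem_arithmeticLevel_iff.2 ⟨γ₂.2, hmem.2⟩
  have hγ₂1 : γ₂ = 1 :=
    Subtype.ext (eq_one_of_mem_arithmeticLevel_fin_one F E c J₂ hfix hJ₂ hn le_rfl hγ₂)
  subst hγ₂1
  exact ⟨γ₁, Subtype.ext hγ⟩

/-- **CM form of `exists_eq_embRational_of_mulVec_frameEmb_of_mem_level`** (`E = L` a CM field, `F = L⁺`, `c` = complex conjugation,
which fixes every infinite place — ★ `complexConj_smul_infinitePlace`): the shape consumed at the face `(L, J⋆, J⊥, H, B)` with
`φ := φGS L J⋆ J⊥ H B ha hB` and `hφ := φGS_apply`. [cite: Deligne1971TravauxShimura, Prop. 1.15 (proof, pp. 132–133)] [cite: Minkowski1887, §1] -/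
theorem exists_eq_embRational_of_mulVec_frameEmb_of_mem_level_cm (L : Type) [Field L] [NumberField L] [IsCMField L]
    (J₁ : Matrix (Fin N₁) (Fin N₁) L) (J₂ : Matrix (Fin 1) (Fin 1) L) (H : Matrix (Fin (N₁ + 1)) (Fin (N₁ + 1)) L)
    (B : GL (Fin (N₁ + 1)) L) {a : L} (ha : a ≠ 0)
    (hB : formCongr ((IsCMField.complexConj L : L ≃ₐ[↥(NumberField.maximalRealSubfield L)] L) : L →+* L) B (a • H) = finSum N₁ 1 J₁ J₂)
    (hJ₁ : J₁.det ≠ 0) (hJ₂ : J₂.det ≠ 0) {n : ℕ} (hn : 3 ≤ n)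
    {φ : finAdelic ↥(NumberField.maximalRealSubfield L) L (IsCMField.complexConj L) N₁ J₁ →*
      finAdelic ↥(NumberField.maximalRealSubfield L) L (IsCMField.complexConj L) (N₁ + 1) H}
    (hφ : ∀ u, φ u = finAdelicCongr ↥(NumberField.maximalRealSubfield L) L (IsCMField.complexConj L) B ha hB
      (finAdelicBlockDiag ↥(NumberField.maximalRealSubfield L) L (IsCMField.complexConj L) N₁ 1 J₁ J₂ (u, 1)))
    {K : Subgroup (finAdelic ↥(NumberField.maximalRealSubfield L) L (IsCMField.complexConj L) (N₁ + 1) H)}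
    (hK : K ≤ (finCongruenceLevel ↥(NumberField.maximalRealSubfield L) L (IsCMField.complexConj L) (N₁ + 1) (finSum N₁ 1 J₁ J₂)
      (Ideal.span {(n : NumberField.RingOfIntegers L)})).map
      (finAdelicCongr ↥(NumberField.maximalRealSubfield L) L (IsCMField.complexConj L) B ha hB).toMonoidHom)
    (γ : rational ↥(NumberField.maximalRealSubfield L) L (IsCMField.complexConj L) (N₁ + 1) H)
    (u u' : finAdelic ↥(NumberField.maximalRealSubfield L) L (IsCMField.complexConj L) N₁ J₁)
    (hV : ∀ x : Fin N₁ → L, ∃ y : Fin N₁ → L,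
      ((γ : GL (Fin (N₁ + 1)) L) : Matrix (Fin (N₁ + 1)) (Fin (N₁ + 1)) L) *ᵥ
          ((B : Matrix (Fin (N₁ + 1)) (Fin (N₁ + 1)) L) *ᵥ Fin.append x (0 : Fin 1 → L)) =
        (B : Matrix (Fin (N₁ + 1)) (Fin (N₁ + 1)) L) *ᵥ Fin.append y (0 : Fin 1 → L))
    (hcoset : (φ u)⁻¹ * (rationalToFinAdelic ↥(NumberField.maximalRealSubfield L) L (IsCMField.complexConj L) (N₁ + 1) H γ * φ u') ∈ K) :
    ∃ γs : rational ↥(NumberField.maximalRealSubfield L) L (IsCMField.complexConj L) N₁ J₁,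
      γ = embRational ↥(NumberField.maximalRealSubfield L) L (IsCMField.complexConj L) N₁ 1 J₁ J₂ H B ha hB γs :=
  exists_eq_embRational_of_mulVec_frameEmb_of_mem_level ↥(NumberField.maximalRealSubfield L) L (IsCMField.complexConj L) N₁ J₁ J₂
    H B ha hB (complexConj_smul_infinitePlace L) hJ₁ hJ₂ hn hφ hK γ u u' hV hcoset

end CaseA


end Literature.NumberTheory.Automorphic.UnitaryGroup

end
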